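import Literature.NumberTheory.EllipticCurves.BSDShaProofs
import Literature.GroupTheory.FiniteAbelian.SymplecticModules
import Mathlib.GroupTheory.SpecificGroups.Cyclic
import HarnessLib

/-!
# Route `PrintX6`, crux `EisensteinHalfFiveLeRest` (stmt-BirchSwinnertonDyer-21116), line `log-witness`:
# the Cassels–Tate SQUARING step of stub S1 (`stub_shaSquare_of_logWronskian`)

Cell `bsd-print-x6`, seat x6-p2 LEAD g4 (prover-bsd-line-x6-p2-g4-0). HONEST FRAMING: a helper
(`--supports` stmt-BirchSwinnertonDyer-21116); it closes no registered stub and no item; BSD is not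
proved by any of this; no summit statement is proved by this seat.

The published line `Cruxes/EisensteinHalfFiveLeRest/Lines/log_witness.lean` (bsd-idea-19) derives its
stub S1 — `ord_p #Ш(E) ≥ 2·(v' − min(v', w))` — in four steps (LEAD READ
`Cruxes/EisensteinHalfFiveLeRest/Lines/log-witness-lead-read.md` §1): (a) Kobayashi's level-`0` Coleman
coordinates, (b) Kato's integral class on the global line, (c) the Poitou–Tate count producing a CYCLIC
quotient of `Sel_{p^∞}(E/ℚ) = Ш(E)[p^∞]` of order `p^{v'−∂}`, and (d) the SQUARING: by the Cassels–Tate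
pairing a finite `Ш` is `N ⊕ N`, so every cyclic quotient `C` of `Ш(E)` satisfies `(#C)² ∣ #Ш(E)`, i.e.
`2·ord_p #C ≤ ord_p #Ш(E)`. This file proves step (d) for every elliptic curve over every number field,
from the tree's Cassels–Tate fact `exists_casselsTate_pairing` (bsd.S18, displayed hypothesis — UNPROVED
in the tree, refereed print: Cassels 1962 / Tate 1962, Silverman AEC Thm. X.4.14) and the PROVED structure
theorem `Literature.GroupTheory.FiniteAbelian.exists_addEquiv_prod_self` (Wall 1963 Lemma 7 /
Tignol–Amitsur 1986 Thm. 4.1).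

## Contents

* §1 `natCard_sq_dvd_of_surjective_of_isAddCyclic` — pure algebra: a finite abelian group `T` with a
  nondegenerate alternating `ℚ/ℤ`-pairing and a surjection `T ↠ C` onto a cyclic group has `(#C)² ∣ #T`
  (`#C = exp C ∣ exp T ∣ exp(L × L) = exp L ∣ #L`, `#T = (#L)²`).
* §2 `natCard_sq_dvd_card_sha_of_casselsTate` — the same for `T = Ш(E/K)` finite, from bsd.S18.
* §3 `two_mul_padicValNat_le_padicValNat_shaOrder_of_casselsTate` and
  `two_mul_le_padicValNat_shaOrder_of_natCard_eq_pow` — the valuation forms used by S1: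
  `2·ord_p #C ≤ ord_p #Ш(E/K)`, and `#C = p^d ⇒ 2d ≤ ord_p #Ш(E/K)`.

References: [SilvermanAEC2009] Thm. X.4.14 and Exercise 10.20; [Cassels1962ArithmeticIV];
[Tate1963DualityICM]; [Wall1963QuadraticFormsFiniteGroups] Lemma 7; [TignolAmitsur1986SymplecticModules]
Thm. 4.1; [Kobayashi2003] (7.18) (the consumer, step (c)).
-/

set_option autoImplicit false

set_option linter.dupNamespace false

noncomputable section

open Literature.NumberTheory.EllipticCurves Literature.GroupTheory.FiniteAbelian WeierstrassCurve

namespace Summit.BirchSwinnertonDyer.BirchSwinnertonDyer.Theorems.PrintX6.LogWitness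

universe u v

/-! ## §1. Cyclic quotients of a symplectic finite abelian group -/

/-- **A cyclic quotient of a symplectic finite abelian group has order at most the square root.**
If `T` is a finite abelian group with a bi-additive alternating (`B x x = 0`) left-nondegenerate
pairing `B : T × T → ℚ/ℤ`, and `f : T → C` is a surjective homomorphism onto a cyclic group, then
`(#C)² ∣ #T`. Proof: `T ≃ L × L` (Wall 1963 / Tignol–Amitsur 1986, tree theorem
`exists_addEquiv_prod_self`), so `#T = (#L)²`, while `#C = exp C ∣ exp T = exp(L × L) = exp L ∣ #L`.
[cite: Wall1963QuadraticFormsFiniteGroups, Lemma 7] [cite: TignolAmitsur1986SymplecticModules, Thm. 4.1] -/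
theorem natCard_sq_dvd_of_surjective_of_isAddCyclic {T : Type u} [AddCommGroup T] [Finite T]
    (B : T →+ T →+ AddCircle (1 : ℚ)) (halt : ∀ x, B x x = 0)
    (hnd : ∀ x, (∀ y, B x y = 0) → x = 0) {C : Type v} [AddCommGroup C] [IsAddCyclic C]
    (f : T →+ C) (hf : Function.Surjective f) : Nat.card C ^ 2 ∣ Nat.card T := by
  obtain ⟨L, -, ⟨e⟩⟩ := exists_addEquiv_prod_self B halt hnd
  have h1 : Nat.card C ∣ AddMonoid.exponent T := by
    rw [← IsAddCyclic.exponent_eq_card]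
    exact AddMonoidHom.exponent_dvd hf
  have h2 : AddMonoid.exponent T ∣ AddMonoid.exponent L := by
    have h : AddMonoid.exponent T ∣ AddMonoid.exponent (L × L) :=
      AddMonoidHom.exponent_dvd (f := e.symm) e.symm.surjective
    rw [AddMonoid.exponent_prod] at h
    exact h.trans (lcm_dvd dvd_rfl dvd_rfl)
  have h3 : AddMonoid.exponent L ∣ Nat.card L := AddGroup.exponent_dvd_nat_card
  have hT : Nat.card T = Nat.card L ^ 2 := by
    rw [Nat.card_congr e.toEquiv, Nat.card_prod, sq]
  rw [hT]
  exact pow_dvd_pow_of_dvd (h1.trans (h2.trans h3)) 2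

/-- Valuation form of `natCard_sq_dvd_of_surjective_of_isAddCyclic`: for a prime `p`,
`2 · ord_p #C ≤ ord_p #T`. [cite: Wall1963QuadraticFormsFiniteGroups, Lemma 7] -/
theorem two_mul_padicValNat_natCard_le_of_surjective_of_isAddCyclic {T : Type u} [AddCommGroup T]
    [Finite T] (B : T →+ T →+ AddCircle (1 : ℚ)) (halt : ∀ x, B x x = 0)
    (hnd : ∀ x, (∀ y, B x y = 0) → x = 0) {C : Type v} [AddCommGroup C] [IsAddCyclic C]
    (f : T →+ C) (hf : Function.Surjective f) (p : ℕ) [Fact p.Prime] :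
    2 * padicValNat p (Nat.card C) ≤ padicValNat p (Nat.card T) := by
  have hT : Nat.card T ≠ 0 := Nat.card_pos.ne'
  have h := natCard_sq_dvd_of_surjective_of_isAddCyclic B halt hnd f hf
  have h' : p ^ padicValNat p (Nat.card C ^ 2) ∣ Nat.card T := pow_padicValNat_dvd.trans h
  rw [padicValNat_dvd_iff_le hT, padicValNat.pow (Nat.card C) 2] at h'
  exact h'

/-! ## §2. The Cassels–Tate squaring for `Ш(E/K)` -/

variable {K : Type u} [Field K] [NumberField K]

/-- **Every cyclic quotient `C` of a finite `Ш(E/K)` has `(#C)² ∣ #Ш(E/K)`** (granted the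
Cassels–Tate pairing fact bsd.S18 `exists_casselsTate_pairing`: alternating, kernel = divisible
elements; a finite group has no non-zero divisible element, so the pairing is nondegenerate and §1
applies). This is step (d) of stub S1 of the line `log-witness` on crux
stmt-BirchSwinnertonDyer-21116, for every elliptic curve over every number field.
[cite: SilvermanAEC2009, Thm. X.4.14] [cite: Cassels1962ArithmeticIV] [cite: Tate1963DualityICM] -/
theorem natCard_sq_dvd_card_sha_of_casselsTate (hCT : exists_casselsTate_pairing (K := K))
    (W : WeierstrassCurve K) [W.IsElliptic] [Finite W.sha] {C : Type v} [AddCommGroup C]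
    [IsAddCyclic C] (f : W.sha →+ C) (hf : Function.Surjective f) :
    Nat.card C ^ 2 ∣ Nat.card W.sha := by
  obtain ⟨B, halt, hker⟩ := hCT W
  refine natCard_sq_dvd_of_surjective_of_isAddCyclic B halt (fun a ha => ?_) f hf
  have hmem : a ∈ AddSubgroup.divisibleElements W.sha := (hker a).mp ha
  rwa [divisibleElements_eq_bot_of_finite, AddSubgroup.mem_bot] at hmem

/-! ## §3. Valuation forms (the shape consumed by S1: `2(m − e) ≤ padicValNat p W.shaOrder`) -/

/-- **`2 · ord_p #C ≤ ord_p #Ш(E/K)`** for every cyclic quotient `C` of a finite `Ш(E/K)` and every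
prime `p` (granted bsd.S18); `W.shaOrder = #Ш(E/K)` by definition.
[cite: SilvermanAEC2009, Thm. X.4.14] [cite: Cassels1962ArithmeticIV] -/
theorem two_mul_padicValNat_le_padicValNat_shaOrder_of_casselsTate
    (hCT : exists_casselsTate_pairing (K := K)) (W : WeierstrassCurve K) [W.IsElliptic]
    [Finite W.sha] (p : ℕ) [Fact p.Prime] {C : Type v} [AddCommGroup C] [IsAddCyclic C]
    (f : W.sha →+ C) (hf : Function.Surjective f) :
    2 * padicValNat p (Nat.card C) ≤ padicValNat p W.shaOrder := by
  obtain ⟨B, halt, hker⟩ := hCT W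
  refine two_mul_padicValNat_natCard_le_of_surjective_of_isAddCyclic B halt (fun a ha => ?_) f hf p
  have hmem : a ∈ AddSubgroup.divisibleElements W.sha := (hker a).mp ha
  rwa [divisibleElements_eq_bot_of_finite, AddSubgroup.mem_bot] at hmem

/-- **A cyclic quotient of order `p^d` of a finite `Ш(E/K)` forces `2d ≤ ord_p #Ш(E/K)`** (granted
bsd.S18). In the line `log-witness` this is applied with `d = v' − ∂` (the Poitou–Tate count of the
image of `Sel_{p^∞}(E/ℚ) = Ш(E)[p^∞]` in `E(ℚ_p) ⊗ ℚ_p/ℤ_p ≅ ℚ_p/ℤ_p`, Kobayashi 2003 (7.18)), giving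
`ord_p #Ш(E) ≥ 2(v' − ∂) ≥ 2(v' − min(v', w))`.
[cite: SilvermanAEC2009, Thm. X.4.14] [cite: Cassels1962ArithmeticIV] [cite: Kobayashi2003, (7.18) (p. 12)] -/
theorem two_mul_le_padicValNat_shaOrder_of_natCard_eq_pow
    (hCT : exists_casselsTate_pairing (K := K)) (W : WeierstrassCurve K) [W.IsElliptic]
    [Finite W.sha] (p d : ℕ) [Fact p.Prime] {C : Type v} [AddCommGroup C] [IsAddCyclic C]
    (f : W.sha →+ C) (hf : Function.Surjective f) (hC : Nat.card C = p ^ d) :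
    2 * d ≤ padicValNat p W.shaOrder := by
  have h := two_mul_padicValNat_le_padicValNat_shaOrder_of_casselsTate hCT W p f hf
  rwa [hC, padicValNat.prime_pow] at h

/-! ## §4. Stub S1b of the published line `log-witness` (v2), BY NAME modulo the Cassels–Tate fact

In v2 of `Cruxes/EisensteinHalfFiveLeRest/Lines/log_witness.lean` (x6-p2 LEAD g4, reshape proposed by
x6-p2-w2 g4) stub S1 is split into S1a `stub_logDeficitCyclicQuotient` (the level-`0` log-deficit
cyclic quotient `Ш(E) ↠ ℤ/p^{m−e}`, typer-gated) and S1b `stub_shaSquare_of_cyclicQuotient` (the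
squaring). The theorem below is S1b's registered TEXT, verbatim, as a function of bsd.S18. -/

/-- **Stub S1b of line `log-witness` BY NAME, modulo the Cassels–Tate fact**: granted
`exists_casselsTate_pairing (K := ℚ)` (bsd.S18; Cassels 1962 / Tate 1962, Silverman AEC Thm. X.4.14 —
refereed print, UNPROVED in the tree), for every elliptic curve `E/ℚ`, prime `p` and `k`, if `Ш(E)` is
finite and surjects onto `ℤ/p^k` then `2k ≤ ord_p #Ш(E)`. The text after the fact binder is literally
`LogWitness.stub_shaSquare_of_cyclicQuotient` of the workfile (v2); proof = §3 with `C = ZMod (p^k)`,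
`#C = p^k`. Credit on a registered skeleton would need a route Input item for bsd.S18 (planner).
[cite: SilvermanAEC2009, Thm. X.4.14] [cite: Cassels1962ArithmeticIV] [cite: Tate1963DualityICM] -/
theorem stub_shaSquare_of_cyclicQuotient_of_casselsTate
    (hCT : exists_casselsTate_pairing (K := ℚ)) :
    ∀ (W : WeierstrassCurve ℚ) [W.IsElliptic] (p k : ℕ) [Fact p.Prime], Finite W.sha →
      (∃ φ : W.sha →+ ZMod (p ^ k), Function.Surjective φ) → 2 * k ≤ padicValNat p W.shaOrder := by
  intro W _ p k _ hfin hφ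
  obtain ⟨φ, hφ⟩ := hφ
  exact two_mul_le_padicValNat_shaOrder_of_natCard_eq_pow hCT W p k φ hφ (Nat.card_zmod (p ^ k))

end Summit.BirchSwinnertonDyer.BirchSwinnertonDyer.Theorems.PrintX6.LogWitness

end
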